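import Literature.NumberTheory.Transcendental.KZLogCalculusProofs
import Literature.NumberTheory.Transcendental.KZDominatedFamilyRelations
import Literature.NumberTheory.Transcendental.EllIterRep
import Summits.KontsevichZagierPeriods.KontsevichZagierPeriods.Theorems.BetaCancellation.Negative.KernelForm
import Summits.KontsevichZagierPeriods.KontsevichZagierPeriods.Theorems.NormalFormPrinciple.Negative.WindowInvariant

/-!
# `NormalFormPrinciple` (stmt-KontsevichZagierPeriods-3869), line `SketchIdeator1` — registered
# sub-goal `slabA_sub_pt_mem_relations`: Newton–Leibniz over the point, algebraic ends

Pure proof file (`--supports` the crux; siege attempt k20, "explicit certificate of moves").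
The registered sub-goal of the algebraic-pole layer of the leaf `stub_boxRigidity` (lead seat c3,
file `AlgKit`): for real ALGEBRAIC `α ≤ β`, an interval representation `N = [(α,β), f]` and a
primitive `F` of `f` on `(α,β)` which is continuous on `[α,β]` and `ℚ`-semialgebraic (read on the
first coordinate) on the closed slab, `[N] − [pt, F(β) − F(α)] ∈ KZ.relations` for every point
representation over `ℝ⁰` with that constant.

The proof is an explicit certificate of moves of the Kontsevich–Zagier calculus:

* the closed-slab representation `R = [[α,β], f]` exists (`f` is `N.integrand` a.e.; the closed
  slab with algebraic ends is `ℚ`-semialgebraic, `isSemialgebraic_setOf_apply_mem_Icc_of_isAlgebraic`);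
* ONE Newton–Leibniz generator over the point (rule 3 with `n = 0`): `[R] − [Z] ∈ newtonLeibnizRel`
  with the witness `(a, b, F) = (α, β, z ↦ F(z₀))` — algebraic constants are `ℚ`-semialgebraic
  functions (`isSemialgebraicFunOn_const_of_isAlgebraic`);
* the two endpoints are null hyperplanes, so `[R] − [R|(α,β)] ∈ relations` (rule 1a,
  `KZ.IntegralRep.of_sub_of_restrict_mem_relations`), and `[R|(α,β)] − [N] ∈ relations` by
  congruence of integrands on the common domain (`KZ.of_sub_of_mem_relations_of_eqOn`).

This is the algebraic-endpoint version of `PiBox.Dlog.slab_sub_pt_mem_relations`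
(`…NormalFormPrincipleSplitMoves.lean`, rational ends and a `ℚ`-rational primitive).

Sources: M. Kontsevich, D. Zagier, *Periods* (2001), §1.2 rules (1), (3); J. Bochnak, M. Coste,
M.-F. Roy, *Real Algebraic Geometry* (1998), §2.1–2.2. No definitions are introduced.
-/

noncomputable section

open MeasureTheory Set
open Literature.NumberTheory.Transcendental Literature.NumberTheory.Transcendental.KZ
open Literature.ModelTheory.ExponentialFields (IsSemialgebraic isSemialgebraic_univ)

namespace Summit.KontsevichZagierPeriods.HurwitzMicroSectors.NormalFormPrinciple.PiBox

namespace SlabAK20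

open Summit.KontsevichZagierPeriods.HurwitzMicroSectors.NormalFormPrinciple.Negative
  (integrableOn_fin_one)
open Summit.KontsevichZagierPeriods.KontsevichZagierPeriods.BetaCancellationNegative
  (volume_setOf_apply_eq_zero)

/-- The closed coordinate slab `{x | a ≤ x i ≤ b} ⊂ ℝⁿ` with real ALGEBRAIC ends is
`ℚ`-semialgebraic (complement of `{x i < a} ∪ {b < x i}`). [cite: BochnakCosteRoy1998, §2.1] -/
theorem isSemialgebraic_setOf_apply_mem_Icc_of_isAlgebraic {n : ℕ} {a b : ℝ}
    (ha : IsAlgebraic ℚ a) (hb : IsAlgebraic ℚ b) (i : Fin n) :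
    IsSemialgebraic ℚ {x : Fin n → ℝ | x i ∈ Set.Icc a b} := by
  have h : {x : Fin n → ℝ | x i ∈ Set.Icc a b} = ({x : Fin n → ℝ | x i < a} ∪ {x | b < x i})ᶜ := by
    ext x
    simp only [mem_setOf_eq, mem_Icc, mem_compl_iff, mem_union, not_or, not_lt]
  rw [h]
  exact ((isSemialgebraic_setOf_apply_lt_const ha i).union
    (isSemialgebraic_setOf_const_lt_apply hb i)).compl

/-- **Newton–Leibniz over the point, algebraic ends** (registered sub-goal
`slabA_sub_pt_mem_relations` of crux stmt-KontsevichZagierPeriods-3869). Let `α ≤ β` be real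
algebraic, `N = [(α,β), f]` an interval representation whose integrand `x ↦ f(x₀)` is
`ℚ`-semialgebraic on the closed slab, and `F` a primitive of `f` on `(α,β)`, continuous on `[α,β]`
and `ℚ`-semialgebraic on the closed slab. Then `[N] − [Z] ∈ relations` for every point
representation `Z = [pt, F(β) − F(α)]` over `ℝ⁰`: one Newton–Leibniz generator (rule 3 over the
point) from the closed slab, the null endpoints (rule 1a) and a congruence of integrands.
[cite: KontsevichZagier2001, §1.2 rule (3)] -/
theorem slabA_sub_pt_mem_relations {α β : ℝ} (hα : IsAlgebraic ℚ α) (hβ : IsAlgebraic ℚ β)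
    (hαβ : α ≤ β) (f F : ℝ → ℝ)
    (hF : IsSemialgebraicFunOn ℚ {x : Fin 1 → ℝ | x 0 ∈ Set.Icc α β} (fun x => F (x 0)))
    (hFc : ContinuousOn F (Set.Icc α β))
    (hderiv : ∀ t ∈ Set.Ioo α β, HasDerivAt F (f t) t)
    (hf : IsSemialgebraicFunOn ℚ {x : Fin 1 → ℝ | x 0 ∈ Set.Icc α β} (fun x => f (x 0)))
    (N : IntegralRep 1) (hNd : N.domain = {x | x 0 ∈ Set.Ioo α β})
    (hNi : EqOn N.integrand (fun x => f (x 0)) N.domain)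
    (Z : IntegralRep 0) (hZd : Z.domain = univ) (hZi : Z.integrand = fun _ => F β - F α) :
    of N - of Z ∈ relations := by
  set C : Set (Fin 1 → ℝ) := {x | x 0 ∈ Set.Icc α β} with hC
  have hCsa : IsSemialgebraic ℚ C := isSemialgebraic_setOf_apply_mem_Icc_of_isAlgebraic hα hβ 0
  -- the open slab is `N.domain`, hence `ℚ`-semialgebraic
  have hOsa : IsSemialgebraic ℚ {x : Fin 1 → ℝ | x 0 ∈ Set.Ioo α β} := hNd ▸ N.isSemialgebraic_domain
  -- the integrand `f` on the closed slab is integrable (it is `N.integrand` a.e.)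
  have hfi : IntegrableOn (fun x : Fin 1 → ℝ => f (x 0)) C := by
    have h1 : IntegrableOn (fun x : Fin 1 → ℝ => f (x 0)) N.domain :=
      N.integrableOn.congr_fun hNi (IsSemialgebraic.measurableSet_holds N.isSemialgebraic_domain)
    rw [hNd, integrableOn_fin_one] at h1
    rw [hC, integrableOn_fin_one]
    exact h1.congr_set_ae (Ioo_ae_eq_Icc (a := α) (b := β)).symm
  -- the closed-slab representation `R = [[α,β], f]`
  obtain ⟨R, hRd, hRi⟩ : ∃ R : IntegralRep 1, R.domain = C ∧ R.integrand = fun x => f (x 0) :=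
    ⟨⟨C, fun x => f (x 0), hCsa, hf, hfi⟩, rfl, rfl⟩
  have hs0 : ∀ (x : Fin 0 → ℝ) (t : ℝ), (Fin.snoc x t : Fin 1 → ℝ) 0 = t := fun _ _ => rfl
  -- (i) ONE Newton–Leibniz move over `ℝ⁰`: `[R] − [Z] ∈ newtonLeibnizRel`, primitive `F (z 0)`
  have hNL : of R - of Z ∈ newtonLeibnizRel := by
    refine ⟨0, R, Z, fun _ => α, fun _ => β, fun z => F (z 0), ?_, ?_, ?_,
      fun _ _ => hαβ, ?_, ?_, ?_, ?_, rfl⟩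
    · rw [hRd]
      exact hF
    · rw [hZd]
      exact isSemialgebraicFunOn_const_of_isAlgebraic isSemialgebraic_univ hα
    · rw [hZd]
      exact isSemialgebraicFunOn_const_of_isAlgebraic isSemialgebraic_univ hβ
    · rw [hRd, hZd, hC]
      ext z
      simp only [Set.mem_setOf_eq, Set.mem_Icc, Set.mem_univ, true_and]
      rfl
    · -- continuity of `t ↦ F t` on the closed fibre
      intro x _
      simp only [hs0]
      exact hFc
    · -- derivative on the open fibre
      intro x _ t ht
      rw [hRi]
      simp only [hs0]
      exact hderiv t ht
    · intro x _
      rw [hZi]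
      simp only [hs0]
  -- (ii) closed slab versus the open slab `N.domain` (null endpoints), and congruence with `N`
  have hEsub : {x : Fin 1 → ℝ | x 0 ∈ Set.Ioo α β} ⊆ R.domain := by
    rw [hRd, hC]
    exact fun x hx => Set.Ioo_subset_Icc_self hx
  have hnull : volume (R.domain \ {x : Fin 1 → ℝ | x 0 ∈ Set.Ioo α β}) = 0 := by
    refine measure_mono_null (fun x hx => ?_)
      (measure_union_null (volume_setOf_apply_eq_zero (0 : Fin 1) α)
        (volume_setOf_apply_eq_zero (0 : Fin 1) β))
    rw [hRd, hC] at hx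
    obtain ⟨⟨h1, h2⟩, h3⟩ := hx
    simp only [Set.mem_setOf_eq, Set.mem_Ioo, not_and, not_lt] at h3
    simp only [Set.mem_union, Set.mem_setOf_eq]
    rcases h1.lt_or_eq with h1 | h1
    · exact Or.inr (le_antisymm h2 (h3 h1))
    · exact Or.inl h1.symm
  have h2 : of R - of (R.restrict _ hOsa hEsub) ∈ relations :=
    R.of_sub_of_restrict_mem_relations hOsa hEsub hnull
  have h3 : of (R.restrict _ hOsa hEsub) - of N ∈ relations :=
    of_sub_of_mem_relations_of_eqOn (by rw [hNd]; rfl) fun x hx => by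
      rw [IntegralRep.integrand_restrict, hRi, hNi (by rw [hNd]; exact hx)]
  have : of N - of Z = (of R - of Z) - (of R - of (R.restrict _ hOsa hEsub)) -
      (of (R.restrict _ hOsa hEsub) - of N) := by abel
  rw [this]
  exact relations.sub_mem (relations.sub_mem (newtonLeibnizRel_subset_relations hNL) h2) h3

end SlabAK20

end Summit.KontsevichZagierPeriods.HurwitzMicroSectors.NormalFormPrinciple.PiBox
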